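import Mathlib
import HarnessLib
import Summits.NavierStokesRegularity.NavierStokesRegularity.Theorems.TaylorModelRungThreeCertificateStageNumerics
import Summits.NavierStokesRegularity.NavierStokesRegularity.Theorems.TaylorModelRungThreeCertificateReadoutsSound
import Summits.NavierStokesRegularity.NavierStokesRegularity.Theorems.TaylorModelRungThreeCertificateSoundStep

/-!
# Crux K1b-DR (stmt-NavierStokesRegularity-23954), line `taylor-model` — certificate SOUNDNESS for the
# `StageNumerics` block, part 1: surrogates and the scalar clauses (N)

For a monotone ring map `φ : K →+* ℝ` we prove, from `checkStageAux T A B = true`, the real inequalities the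
surrogates stand for (`2^(−θ) ≤ φ pU`, `2^θ ≤ φ PU`, `2^(3(Kb+1)/4) ≤ φ r34U`, `√(10·Cg·2^(−7(Ka+1))) ≤ φ tv`,
`√(M_k²/2 + η₀W_k) ≤ φ rM_k`), and from `checkSN_scalars` the scalar clauses (N) of `CertData.StageNumerics`
for the interpreted record `T.toCertData φ` (the exit-functional clause (U), the truncation defect (DIST) and the
bilinear bound (B) follow in the `…StageNumerics{Exit,Defect,Bilin}` files). All helper names carry
the prefix `sn_` (no overlap with the `Chain` / `Readouts` soundness files, whose lemmas are imported BY NAME: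
`toCertData_*` projections, `phi_*`, `phi_sumN`, `abs_covR_le`, `covR_nil`, `vget_of_le`, `omega_wk`, `wv_idx`, …).

MODEL-lattice bookkeeping only (rung TL-M3); nothing here concerns the Navier–Stokes equations.
-/

-- the sub-problem namespace repeats the summit name by design (D-0017)
set_option linter.dupNamespace false

namespace Summit.NavierStokesRegularity.NavierStokesRegularity.Theorems.TaylorModelCert

open scoped BigOperators
open Literature.Analysis.FluidPDE.TaoCascade Literature.Analysis.FluidPDE.TaoCascade.TaylorChain

namespace CertTables

section Proj

variable {K : Type} [Field K] (φ : K →+* ℝ) (T : CertTables K)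

/-! ### Projections of the interpreted record used by this block (all `rfl`) -/

/-- `θ`. [folklore] -/
theorem sn_θ : (T.toCertData φ).θ = φ T.θ := rfl
/-- `η₀`. [folklore] -/
theorem sn_η₀ : (T.toCertData φ).η₀ = φ T.η₀ := rfl
/-- `Cb`. [folklore] -/
theorem sn_Cb : (T.toCertData φ).Cb = φ T.Cb := rfl
/-- `Cg`. [folklore] -/
theorem sn_Cg : (T.toCertData φ).Cg = φ T.Cg := rfl
/-- `nx`. [folklore] -/
theorem sn_nx (j : ℕ) : (T.toCertData φ).nx j = (T.stage j).nx := rfl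
/-- `Lv`. [folklore] -/
theorem sn_Lv (j : ℕ) : (T.toCertData φ).Lv j = φ (T.stage j).Lv := rfl
/-- `as`. [folklore] -/
theorem sn_as (j : ℕ) : (T.toCertData φ).as j = φ (T.stage j).as := rfl
/-- `s`. [folklore] -/
theorem sn_s (j l : ℕ) : (T.toCertData φ).s j l = φ (vget (T.stage j).s l) := rfl
/-- `ℓ`. [folklore] -/
theorem sn_ℓ (j l : ℕ) : (T.toCertData φ).ℓ j l = T.covR φ ((T.stage j).ell.getD l []) := rfl
/-- `ω` as the `K`-side `wShell`. [folklore] -/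
theorem sn_ω (j : ℕ) (k : ℤ) : (T.toCertData φ).ω j k = φ (T.wShell j k) := by
  show (if -T.Kb ≤ k ∧ k ≤ T.Ka then φ (vget (T.stage j).ω (k + T.Kb).toNat) else 1) = _
  unfold wShell
  split_ifs <;> simp
/-- `M` on the window. [folklore] -/
theorem sn_M {k : ℤ} (hk : -T.Kb ≤ k ∧ k ≤ T.Ka) : (T.toCertData φ).M k = φ (T.Mw (k + T.Kb).toNat) := by
  show (if -T.Kb - 1 ≤ k ∧ k ≤ T.Ka + 1 then φ (vget T.M (k + T.Kb + 1).toNat) else 0) = _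
  rw [if_pos ⟨by linarith [hk.1], by linarith [hk.2]⟩]
  unfold Mw
  congr 2
  omega
/-- `W` on the window. [folklore] -/
theorem sn_W {k : ℤ} (hk : -T.Kb ≤ k ∧ k ≤ T.Ka) : (T.toCertData φ).W k = φ (T.Ww (k + T.Kb).toNat) := by
  show (if -T.Kb - 1 ≤ k ∧ k ≤ T.Ka + 1 then φ (vget T.W (k + T.Kb + 1).toNat) else 0) = _
  rw [if_pos ⟨by linarith [hk.1], by linarith [hk.2]⟩]
  unfold Ww
  congr 2
  omega
omit [Field K] in
/-- Window shell index `kk = c % m` of a window coordinate: `(wk c + Kb).toNat = c % m`. [folklore] -/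
theorem sn_wk_toNat (c : ℕ) : (T.wk c + T.Kb).toNat = c % T.m := by
  unfold wk; omega
/-- `wShell` on the window is the stage table at `k + Kb`. [folklore] -/
theorem sn_wShell_of_InW (j : ℕ) {k : ℤ} (hk : -T.Kb ≤ k ∧ k ≤ T.Ka) :
    T.wShell j k = vget (T.stage j).ω (k + T.Kb).toNat := by
  unfold wShell; rw [if_pos hk]
/-- `wgt j c = wShell j (wk c)` for a window coordinate. [folklore] -/
theorem sn_wgt_eq_wShell (j : ℕ) {c : ℕ} (hc : c < T.n) : T.wgt j c = T.wShell j (T.wk c) := by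
  rw [T.sn_wShell_of_InW j (T.InW_wk hc), sn_wk_toNat]
  rfl

end Proj

/-! ### The surrogates -/

section Aux

variable {K : Type} [Field K] [LinearOrder K] {φ : K →+* ℝ} (hφ : Monotone φ) (T : CertTables K)
  {A : ReadoutAux K} {B : StageAux K}
include hφ

omit hφ in
/-- Unpacking `checkStageAux`. [folklore] -/
theorem sn_aux (h : T.checkStageAux A B = true) :
    0 ≤ T.Kb ∧ 1 ≤ T.Ka ∧ 0 < A.θden ∧ T.θ * ((A.θden : ℕ) : K) = ((A.θnum : ℕ) : K) ∧
    (0 < B.pU ∧ 1 ≤ B.pU ^ A.θden * (2 : K) ^ A.θnum) ∧ (0 < B.PU ∧ (2 : K) ^ A.θnum ≤ B.PU ^ A.θden) ∧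
    (0 ≤ B.r34U ∧ (2 : K) ^ (3 * (T.Kb + 1).toNat) ≤ B.r34U ^ 4) ∧
    (0 ≤ A.tv ∧ 10 * T.Cg ≤ A.tv ^ 2 * (2 : K) ^ (7 * (T.Ka + 1).toNat)) ∧
    (0 ≤ T.η₀ ∧ 0 ≤ T.τs ∧ 0 ≤ T.Cb ∧ 0 ≤ T.Cg) ∧ (∀ t < T.m + 2, 0 ≤ vget T.M t) ∧
    (∀ kk < T.m, 0 ≤ vget B.rM kk ∧ (1 / 2 : K) * T.Mw kk ^ 2 + T.η₀ * T.Ww kk ≤ vget B.rM kk ^ 2) := by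
  simp only [checkStageAux, Bool.and_eq_true, decide_eq_true_eq, allN_eq_true] at h
  obtain ⟨⟨⟨⟨⟨⟨⟨⟨⟨⟨⟨⟨⟨⟨⟨⟨⟨hKb, hKa⟩, hden⟩, hθ⟩, hp0⟩, hp⟩, hP0⟩, hP⟩, hr0⟩, hr⟩, ht0⟩, ht⟩, hη⟩, hτ⟩,
    hCb⟩, hCg⟩, hM⟩, hrM⟩ := h
  exact ⟨hKb, hKa, hden, hθ, ⟨hp0, hp⟩, ⟨hP0, hP⟩, ⟨hr0, hr⟩, ⟨ht0, ht⟩, ⟨hη, hτ, hCb, hCg⟩,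
    fun t ht => hM t ht, fun kk hkk => hrM kk hkk⟩

omit hφ in
/-- The real exponent `θ` of the interpreted record is `θnum/θden`. [folklore] -/
theorem sn_theta_eq (h : T.checkStageAux A B = true) :
    (T.toCertData φ).θ = (A.θnum : ℝ) / (A.θden : ℝ) := by
  obtain ⟨-, -, hden, hθ, -⟩ := T.sn_aux h
  have hden' : (0 : ℝ) < A.θden := by exact_mod_cast hden
  rw [sn_θ, eq_div_iff hden'.ne']
  have := congrArg φ hθ
  simpa using this

/-- `2^θ ≤ φ PU`. [folklore] -/
theorem sn_two_rpow_theta_le (h : T.checkStageAux A B = true) :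
    (2 : ℝ) ^ (T.toCertData φ).θ ≤ φ B.PU := by
  obtain ⟨-, -, hden, -, -, ⟨hP0, hP⟩, -⟩ := T.sn_aux h
  rw [T.sn_theta_eq h]
  have hP0' : 0 < φ B.PU := phi_pos hφ hP0
  have hpow : ((2 : ℝ) ^ ((A.θnum : ℝ) / (A.θden : ℝ))) ^ A.θden ≤ (φ B.PU) ^ A.θden := by
    rw [← Real.rpow_natCast, ← Real.rpow_mul (by norm_num), div_mul_cancel₀ _ (by exact_mod_cast hden.ne'),
      Real.rpow_natCast]
    have := hφ hP
    simpa [map_ofNat] using this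
  exact le_of_pow_le_pow_left₀ hden.ne' hP0'.le hpow

/-- `2^(−θ) ≤ φ pU`. [folklore] -/
theorem sn_two_rpow_neg_theta_le (h : T.checkStageAux A B = true) :
    (2 : ℝ) ^ (-(T.toCertData φ).θ) ≤ φ B.pU := by
  obtain ⟨-, -, hden, -, ⟨hp0, hp⟩, -⟩ := T.sn_aux h
  rw [T.sn_theta_eq h]
  have hp0' : 0 < φ B.pU := phi_pos hφ hp0
  have hpow : ((2 : ℝ) ^ (-((A.θnum : ℝ) / (A.θden : ℝ)))) ^ A.θden ≤ (φ B.pU) ^ A.θden := by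
    rw [← Real.rpow_natCast, ← Real.rpow_mul (by norm_num), neg_mul,
      div_mul_cancel₀ _ (by exact_mod_cast hden.ne'), Real.rpow_neg (by norm_num), Real.rpow_natCast]
    -- `(2^θnum)⁻¹ ≤ φ pU ^ θden` from `1 ≤ pU^θden · 2^θnum`
    have h1 : (1 : ℝ) ≤ (φ B.pU) ^ A.θden * (2 : ℝ) ^ A.θnum := by
      have := hφ hp
      simpa [map_ofNat] using this
    have h2 : (0 : ℝ) < (2 : ℝ) ^ A.θnum := by positivity
    rw [inv_eq_one_div, div_le_iff₀ h2]
    exact h1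
  exact le_of_pow_le_pow_left₀ hden.ne' hp0'.le hpow

/-- `2^(3(Kb+1)/4) ≤ φ r34U`. [folklore] -/
theorem sn_r34_le (h : T.checkStageAux A B = true) :
    (2 : ℝ) ^ ((3 : ℝ) / 4 * (((T.toCertData φ).Kb : ℝ) + 1)) ≤ φ B.r34U := by
  obtain ⟨hKb, -, -, -, -, -, ⟨hr0, hr⟩, -⟩ := T.sn_aux h
  have hKb' : ((T.toCertData φ).Kb : ℝ) = (T.Kb : ℝ) := rfl
  have hpow : ((2 : ℝ) ^ ((3 : ℝ) / 4 * ((T.Kb : ℝ) + 1))) ^ 4 ≤ (φ B.r34U) ^ 4 := by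
    rw [← Real.rpow_natCast, ← Real.rpow_mul (by norm_num)]
    have e : (3 : ℝ) / 4 * ((T.Kb : ℝ) + 1) * ((4 : ℕ) : ℝ) = ((3 * (T.Kb + 1).toNat : ℕ) : ℝ) := by
      have h1 : (((T.Kb + 1).toNat : ℕ) : ℝ) = (T.Kb : ℝ) + 1 := by
        have h := Int.toNat_of_nonneg (show 0 ≤ T.Kb + 1 by omega)
        exact_mod_cast h
      push_cast
      rw [h1]; ring
    rw [e, Real.rpow_natCast]
    have := hφ hr
    simpa [map_ofNat] using this
  rw [hKb']
  exact le_of_pow_le_pow_left₀ (by norm_num) (phi_nonneg hφ hr0) hpow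

/-- `√(10·Cg·2^(−7(Ka+1))) ≤ φ tv`. [folklore] -/
theorem sn_tail_le (h : T.checkStageAux A B = true) :
    Real.sqrt (10 * (T.toCertData φ).Cg * (2 : ℝ) ^ (-(7 : ℝ) * (((T.toCertData φ).Ka : ℝ) + 1))) ≤ φ A.tv := by
  obtain ⟨-, hKa, -, -, -, -, -, ⟨ht0, ht⟩, -⟩ := T.sn_aux h
  have hKa' : ((T.toCertData φ).Ka : ℝ) = (T.Ka : ℝ) := rfl
  rw [hKa', sn_Cg]
  have h2pos : (0 : ℝ) < (2 : ℝ) ^ (7 * (T.Ka + 1).toNat) := by positivity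
  have e : (2 : ℝ) ^ (-(7 : ℝ) * ((T.Ka : ℝ) + 1)) = ((2 : ℝ) ^ (7 * (T.Ka + 1).toNat))⁻¹ := by
    have : -(7 : ℝ) * ((T.Ka : ℝ) + 1) = -(((7 * (T.Ka + 1).toNat : ℕ) : ℝ)) := by
      have h1 : (((T.Ka + 1).toNat : ℕ) : ℝ) = (T.Ka : ℝ) + 1 := by
        have h := Int.toNat_of_nonneg (show 0 ≤ T.Ka + 1 by omega)
        exact_mod_cast h
      push_cast
      rw [h1]; ring
    rw [this, Real.rpow_neg (by norm_num), Real.rpow_natCast]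
  rw [e]
  have hle : 10 * φ T.Cg * ((2 : ℝ) ^ (7 * (T.Ka + 1).toNat))⁻¹ ≤ (φ A.tv) ^ 2 := by
    rw [← div_eq_mul_inv, div_le_iff₀ h2pos]
    have := hφ ht
    simpa [map_ofNat] using this
  calc Real.sqrt (10 * φ T.Cg * ((2 : ℝ) ^ (7 * (T.Ka + 1).toNat))⁻¹)
      ≤ Real.sqrt ((φ A.tv) ^ 2) := Real.sqrt_le_sqrt hle
    _ = φ A.tv := Real.sqrt_sq (phi_nonneg hφ ht0)

/-- `√(M_k²/2 + η₀W_k) ≤ φ rM_k` on the window shells. [folklore] -/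
theorem sn_rM_le (h : T.checkStageAux A B = true) {kk : ℕ} (hkk : kk < T.m) :
    Real.sqrt ((1 / 2) * (φ (T.Mw kk)) ^ 2 + φ T.η₀ * φ (T.Ww kk)) ≤ φ (vget B.rM kk) := by
  obtain ⟨-, -, -, -, -, -, -, -, -, -, hrM⟩ := T.sn_aux h
  obtain ⟨hr0, hr⟩ := hrM kk hkk
  have hle : (1 / 2) * (φ (T.Mw kk)) ^ 2 + φ T.η₀ * φ (T.Ww kk) ≤ (φ (vget B.rM kk)) ^ 2 := by
    have := hφ hr
    simpa [map_ofNat] using this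
  exact (Real.sqrt_le_sqrt hle).trans (le_of_eq (Real.sqrt_sq (phi_nonneg hφ hr0)))

end Aux

/-! ### SCALARS -/

section Scalars

variable {K : Type} [Field K] [LinearOrder K] {φ : K →+* ℝ} (hφ : Monotone φ) (T : CertTables K)
  {A : ReadoutAux K} {B : StageAux K}
include hφ

/-- Soundness of `checkSN_scalars`: the scalar clauses (N) of `StageNumerics` at stage `j`, and the amplitude
clause `2^(−θ)·Lv(nx j) ≤ as − Λδτs·ω₁`. [folklore] -/
theorem sn_scalars (hB : T.checkStageAux A B = true) (j : ℕ) (h : T.checkSN_scalars j B = true) :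
    (T.toCertData φ).nx j ≤ (T.toCertData φ).N₀ ∧ 1 ≤ (T.toCertData φ).Lv j ∧
    (∀ l, 0 ≤ (T.toCertData φ).s j l) ∧ 0 < (T.toCertData φ).κ j ∧ 0 ≤ (T.toCertData φ).Λ j ∧
    0 ≤ (T.toCertData φ).δ j ∧ (∀ k, 0 < (T.toCertData φ).ω j k) ∧
    (T.toCertData φ).Λ j * (T.toCertData φ).δ j * (T.toCertData φ).τs < (T.toCertData φ).κ j ∧
    (2 : ℝ) ^ (-(T.toCertData φ).θ) * (T.toCertData φ).Lv ((T.toCertData φ).nx j) ≤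
      (T.toCertData φ).as j - (T.toCertData φ).Λ j * (T.toCertData φ).δ j * (T.toCertData φ).τs *
        (T.toCertData φ).ω j 1 := by
  simp only [checkSN_scalars, Bool.and_eq_true, decide_eq_true_eq, allN_eq_true] at h
  obtain ⟨⟨⟨⟨⟨⟨⟨⟨⟨⟨hnx, hLv⟩, hs⟩, hκ⟩, hΛ⟩, hδ⟩, hω⟩, hprod⟩, hLvn⟩, has⟩, hamp⟩ := h
  refine ⟨hnx, ?_, ?_, ?_, ?_, ?_, ?_, ?_, ?_⟩
  · rw [sn_Lv]; simpa using hφ hLv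
  · intro l
    rw [sn_s]
    by_cases hl : l < (T.stage j).s.length
    · exact phi_nonneg hφ (hs l hl)
    · rw [vget_of_le _ (not_lt.1 hl), map_zero]
  · rw [toCertData_κ]; exact phi_pos hφ hκ
  · rw [toCertData_Λ]; exact phi_nonneg hφ hΛ
  · rw [toCertData_δ]; exact phi_nonneg hφ hδ
  · intro k
    rw [sn_ω]
    unfold wShell
    split_ifs with hk
    · exact phi_pos hφ (hω _ (T.toNat_shell_lt_m hk))
    · simp
  · rw [toCertData_Λ, toCertData_δ, toCertData_τs, toCertData_κ, ← map_mul, ← map_mul]; exact phi_strictMono hφ hprod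
  · obtain ⟨hKb, hKa, -⟩ := T.sn_aux hB
    have hp := T.sn_two_rpow_neg_theta_le hφ hB
    have hLvn' : 0 ≤ φ (T.stage (T.stage j).nx).Lv := phi_nonneg hφ hLvn
    rw [sn_nx, sn_Lv, sn_as, toCertData_Λ, toCertData_δ, toCertData_τs, sn_ω]
    have hw1 : T.wShell j 1 = T.w1 j := rfl
    rw [hw1]
    calc (2 : ℝ) ^ (-(T.toCertData φ).θ) * φ (T.stage (T.stage j).nx).Lv
        ≤ φ B.pU * φ (T.stage (T.stage j).nx).Lv := mul_le_mul_of_nonneg_right hp hLvn'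
      _ = φ (B.pU * (T.stage (T.stage j).nx).Lv) := by rw [map_mul]
      _ ≤ φ ((T.stage j).as - (T.stage j).Λ * (T.stage j).δ * T.τs * T.w1 j) := hφ hamp
      _ = _ := by simp [map_sub, map_mul]

end Scalars

end CertTables

end Summit.NavierStokesRegularity.NavierStokesRegularity.Theorems.TaylorModelCert
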